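import Summits.BirchSwinnertonDyer.BirchSwinnertonDyer.Theorems.GenusKolyvaginAtTwoMinimalTwinBSDTwoOddCutFrobeniusFrameDoor
import Summits.BirchSwinnertonDyer.BirchSwinnertonDyer.Theorems.CMKolyvaginAtInertTwoShaCountJacobiHeegnerAtTwo
import HarnessLib

/-!
# Route `GenusKolyvaginAtTwo`, crux U₂ `MinimalTwinBSDTwo` (stmt-BirchSwinnertonDyer-22985), LINE 23 «twin_swap» — NVFROB AT PRIME FRAMES: the
# Frobenius conditions are AUTOMATIC on `Δ_W < 0` and read «`a_q(W)` odd» on `Δ_W > 0`; so at prime Heegner frames the frame leaf is «a prime twist with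
# `L(W^{(−q)},1) ≠ 0` (+ `a_q` odd if `Δ > 0`) + the door bit»

Seat `bsd-line-gk2-p2` g33 (PROVER seat 2/3, cell `bsd-f1-sign2`, LINE 23 holder), `--supports stmt-BirchSwinnertonDyer-22985 --as helper`.
THEOREMS ONLY (no definition, no named fact, no `sorry`).  BSD is NOT proved by any of this; U₂ is NOT proved; nothing is closed.

WHAT.  NVFROB (p818537; v2.12/v2.13 skeleton leaf) asks for an odd Heegner frame `K` with `L(W^{(d_K)},1) ≠ 0` whose ramified primes satisfy: no `q ∣ d_K`
with `(Δ/q) = 1 ∧ a_q` even, and `#{q ∣ d_K : (Δ/q) = −1} ≤ 𝟙[Δ_W < 0]`.  At a PRIME frame `d_K = −q` the tree's reciprocity computation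
(`ShaCountTwo.jacobiSym_num_Δ_eq_neg_one_of_Δ_neg_of_heegner_prime` / `…_eq_one_of_Δ_pos…`: every prime of `Δ_min` divides `N`, hence splits in `K`,
and `q ≡ 3 (mod 4)`, so `(Δ/q) = sign Δ`) makes these conditions AUTOMATIC when `Δ_W < 0` and EQUIVALENT to «`a_q(W)` odd» (the `2`-division cubic
irreducible mod `q`) when `Δ_W > 0` — p813652's «budget automatic at prime frames» in the Frobenius currency.
* §1 `frobeniusConditions_of_primeFrame` — the two NVFROB conditions at a prime frame from `0 < Δ_W → Odd (a_q)`; `odd_frobeniusTrace_of_frobeniusConditions_of_primeFrame_of_pos` — conversely on `Δ > 0`.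
* §2 `frobeniusFrameDoor_of_primeFrameDoor` — per curve: a prime Heegner frame with `L(W^{(−q)},1) ≠ 0`, (`a_q` odd if `Δ_W > 0`) and the door bit IS an
  NVFROB frame; ★ `minimalTwinBSDTwo_onOddCut_of_wall_of_primeFrameDoorSupply_of_witnessSupply_of_facts` = **U₂|cut ⟸ WALL + PRINT + AU + Čes + Q2 +
  PRIME-NVFROB-supply + WITNESS_{dc,≥2}-supply**, PRIME-NVFROB := per `W` on the cut «(4 ∣ N_W → ∃ odd datum) ∧ ∃ K = ℚ(√−q) Heegner (`q` prime, `d_K` odd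
  `≠ −3`) with `L(W^{(−q)},1) ≠ 0`, (`0 < Δ_W → a_q(W)` odd), and (`#Sel₂(W^{(−q)}) ≠ 1` ∨ [door open] `P(1) ∉ 2W(K[1])` ∀ odd datum)».
So on `Δ_W < 0` research content (A) of the census is EXACTLY «a prime `q ≡ 3 (4)` with every `p ∣ N_W` split in `ℚ(√−q)` and `L(W^{(−q)},1) ≠ 0`»
(prime-twist non-vanishing in a congruence class: Ono–Skinner 1998 give `≫ X/log X` prime-like twists for «good» forms without prescribing the class;
not in print class-wide), and on `Δ_W > 0` the same with `a_q` odd (a Chebotarev condition of density `1/3` inside).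

HONEST FRAMING.  CONDITIONAL on the displayed hypotheses; the supplies are OPEN; nothing beyond print; BSD is NOT proved.

References: [Kramer1981] Prop. 3; [IrelandRosen1990] Prop. 5.2.2; [OnoSkinner1998Invent] Cor. 3; [Ono2001Crelle] Thm. 1; [KrizLi2019FMS] Def. 4.1.
-/

set_option autoImplicit false
set_option linter.dupNamespace false -- `Summit.<P>.<Sub>` repeats `BirchSwinnertonDyer` (D-0017)

noncomputable section

open scoped Classical NumberField

namespace Summit.BirchSwinnertonDyer.BirchSwinnertonDyer.Theorems.GenusExact.TwinSwap.TwinAnnihilation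

open Literature.NumberTheory.EllipticCurves Literature.NumberTheory.GaloisRepresentations WeierstrassCurve NumberField
  IsDedekindDomain Field AddSubgroup Literature.NumberTheory.EllipticCurves.ModularForms
open Summit.BirchSwinnertonDyer.Rank1Residual
open Summit.BirchSwinnertonDyer.BirchSwinnertonDyer.Theses.GenusKolyvaginAtTwo (KolyvaginRelationAtTwo)
open Summit.BirchSwinnertonDyer.BirchSwinnertonDyer.Theorems.ShaCountTwo
  (jacobiSym_num_Δ_eq_neg_one_of_Δ_neg_of_heegner_prime jacobiSym_num_Δ_eq_one_of_Δ_pos_of_heegner_prime)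

/-! ## §1 The Frobenius conditions at a prime frame -/

/-- **At a prime Heegner frame the NVFROB conditions follow from «`a_q` odd if `Δ > 0`».**  `W/ℚ` globally minimal elliptic, `K` imaginary quadratic
with `d_K` odd, Heegner for `N_W`, `|d_K| = q` prime: if `0 < Δ_W → a_q(W)` odd, then no prime factor of `d_K` has `(Δ/·) = 1 ∧ a` even, and the number of
prime factors with `(Δ/·) = −1` is `≤ 𝟙[Δ_W < 0]` (`(Δ/q) = sign Δ_W` by reciprocity, tree theorem). [cite: IrelandRosen1990, Prop. 5.2.2] [cite: Kramer1981, Prop. 3] -/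
theorem frobeniusConditions_of_primeFrame (W : WeierstrassCurve ℚ) [W.IsElliptic] [W.IsGloballyMinimal]
    (K : Type) [Field K] [NumberField K] (hK : IsImaginaryQuadratic K) (hodd : Odd (NumberField.discr K))
    (hH : SatisfiesHeegnerHypothesis (W.conductorNorm ℤ) K) (hq : (NumberField.discr K).natAbs.Prime)
    (hpos : 0 < W.Δ → Odd (W.frobeniusTrace (NumberField.discr K).natAbs)) :
    (∀ q ∈ (NumberField.discr K).natAbs.primeFactors, ¬ (jacobiSym W.Δ.num q = 1 ∧ Even (W.frobeniusTrace q))) ∧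
      ((NumberField.discr K).natAbs.primeFactors.filter (fun q ↦ jacobiSym W.Δ.num q = -1)).card ≤ if W.Δ < 0 then 1 else 0 := by
  have hpf : (NumberField.discr K).natAbs.primeFactors = {(NumberField.discr K).natAbs} := hq.primeFactors
  have hΔ0 : W.Δ ≠ 0 := W.Δ'.ne_zero ∘ fun h ↦ by rw [coe_Δ']; exact h
  rw [hpf]
  rcases lt_or_gt_of_ne hΔ0 with hneg | hposΔ
  · -- `Δ < 0`: `(Δ/q) = −1`, nothing to check, one transposition prime allowed
    have hJ := jacobiSym_num_Δ_eq_neg_one_of_Δ_neg_of_heegner_prime W K hK hodd hH hq hneg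
    refine ⟨fun q hq' ↦ ?_, ?_⟩
    · rw [Finset.mem_singleton] at hq'
      subst hq'
      rw [hJ]
      norm_num
    · rw [if_pos hneg]
      exact (Finset.card_filter_le _ _).trans (by rw [Finset.card_singleton])
  · -- `0 < Δ`: `(Δ/q) = +1`, so the only condition is `a_q` odd
    have hJ := jacobiSym_num_Δ_eq_one_of_Δ_pos_of_heegner_prime W K hK hodd hH hq hposΔ
    refine ⟨fun q hq' ↦ ?_, ?_⟩
    · rw [Finset.mem_singleton] at hq'
      subst hq'
      exact fun h ↦ (Int.not_even_iff_odd.mpr (hpos hposΔ)) h.2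
    · rw [if_neg (not_lt.mpr hposΔ.le), Nat.le_zero, Finset.card_eq_zero, Finset.filter_eq_empty_iff]
      intro q hq'
      rw [Finset.mem_singleton] at hq'
      subst hq'
      rw [hJ]
      norm_num

/-- **Conversely, on `Δ_W > 0` the NVFROB conditions at a prime frame force `a_q(W)` odd** (`(Δ/q) = +1` there, so «no totally split prime» reads
«`a_q` odd»: the `2`-division cubic is irreducible mod `q`). [cite: Kramer1981, Prop. 3] -/
theorem odd_frobeniusTrace_of_frobeniusConditions_of_primeFrame_of_pos (W : WeierstrassCurve ℚ) [W.IsElliptic] [W.IsGloballyMinimal]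
    (K : Type) [Field K] [NumberField K] (hK : IsImaginaryQuadratic K) (hodd : Odd (NumberField.discr K))
    (hH : SatisfiesHeegnerHypothesis (W.conductorNorm ℤ) K) (hq : (NumberField.discr K).natAbs.Prime) (hposΔ : 0 < W.Δ)
    (hno3 : ∀ q ∈ (NumberField.discr K).natAbs.primeFactors, ¬ (jacobiSym W.Δ.num q = 1 ∧ Even (W.frobeniusTrace q))) :
    Odd (W.frobeniusTrace (NumberField.discr K).natAbs) := by
  have hJ := jacobiSym_num_Δ_eq_one_of_Δ_pos_of_heegner_prime W K hK hodd hH hq hposΔ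
  have hmem : (NumberField.discr K).natAbs ∈ (NumberField.discr K).natAbs.primeFactors := by
    rw [hq.primeFactors]; exact Finset.mem_singleton_self _
  by_contra h
  exact hno3 _ hmem ⟨hJ, Int.not_odd_iff_even.mp h⟩

/-! ## §2 A prime Heegner frame with `L ≠ 0` (+ `a_q` odd on `Δ > 0`) and its door bit IS an NVFROB frame -/

/-- ★ **U₂ ON THE WHOLE ODD HABITAT CUT ⟸ WALL row 1 + PRINT + Abbes–Ullmo + Česnavičius + Q2 + PRIME-NVFROB-supply + WITNESS_{dc,≥2}-supply.**
PRIME-NVFROB-supply (`hP`): per `W` on the cut, «(4 ∣ N_W → ∃ odd datum) ∧ ∃ K imaginary quadratic Heegner with `|d_K| = q` PRIME (`d_K` odd `≠ −3`),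
`L(W^{(−q)},1) ≠ 0`, (`0 < Δ_W → a_q(W)` odd), and (`#Sel₂(W^{(−q)}) ≠ 1` ∨ [door open] `P(1) ∉ 2W(K[1])` for every odd datum)» — on `Δ_W < 0` NO
Frobenius condition at all.  Via `frobeniusConditions_of_primeFrame` and p818537.  Both supplies OPEN; CONDITIONAL; closes nothing; BSD is NOT proved.
[cite: Kramer1981, Prop. 3] [cite: IrelandRosen1990, Prop. 5.2.2] [cite: Kolyvagin1989Izv, Thm. A, Thm. B_l] [cite: GrossZagier1986, V.§2 (2.2)] -/
theorem minimalTwinBSDTwo_onOddCut_of_wall_of_primeFrameDoorSupply_of_witnessSupply_of_facts (hQ2 : KolyvaginRelationAtTwo)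
    (hGZ : ∀ (N : ℕ) [NeZero N] (W : WeierstrassCurve ℚ) (K : Type) [Field K] [NumberField K], gross_zagier N W K)
    (hGZK : rank_eq_analyticRank_of_analyticRank_le_one) (hmod : hasEntireLFunction_rat)
    (hMilneC : Milne1972.bsdQuotient_baseChange_quadratic_anyModel) (hMP : nonempty_modularParametrizationData)
    (hAU : abbesUllmo_not_dvd_maninConstant_of_not_dvd_level) (hCes : cesnavicius_not_two_dvd_maninConstant_of_two_dvd_level)
    (hS1 : ∀ (W : WeierstrassCurve ℚ) [W.IsElliptic] [W.IsGloballyMinimal], ¬ W.HasCM → W.analyticRank = 0 → BSDp W 2)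
    (hP : ∀ (W : WeierstrassCurve ℚ) [W.IsElliptic] [W.IsGloballyMinimal] [NeZero (W.conductorNorm ℤ)],
      ¬ W.HasCM → W.analyticRank = 1 → Nat.card (W.selmerGroup 2) = 2 → Odd W.tamagawaProduct →
      (∀ n : ℕ, 0 < n → W.HasSurjectiveModNGaloisRep ((2 : ℤ) ^ n)) →
      (∃ v : HeightOneSpectrum (𝓞 ℚ), ((2 : ℕ) : 𝓞 ℚ) ∉ v.asIdeal ∧ ((W.conductorNorm ℤ : ℕ) : 𝓞 ℚ) ∈ v.asIdeal ∧ W.HasMultiplicativeReductionAt v) →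
      (4 ∣ W.conductorNorm ℤ → ∃ Dt : ModularParametrizationData W (W.conductorNorm ℤ), Odd Dt.c) ∧
      ∃ (K : Type) (_ : Field K) (_ : NumberField K), IsImaginaryQuadratic K ∧ Odd (NumberField.discr K) ∧ NumberField.discr K ≠ -3 ∧
        SatisfiesHeegnerHypothesis (W.conductorNorm ℤ) K ∧ (NumberField.discr K).natAbs.Prime ∧
        (W.quadraticTwist (NumberField.discr K : ℚ)).entireLFunction 1 ≠ 0 ∧
        (0 < W.Δ → Odd (W.frobeniusTrace (NumberField.discr K).natAbs)) ∧
        ∃ (_ : (W.quadraticTwist (NumberField.discr K : ℚ)).IsElliptic),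
          (Nat.card ((W.quadraticTwist (NumberField.discr K : ℚ)).selmerGroup 2) ≠ 1 ∨
            ∀ (Dt : ModularParametrizationData W (W.conductorNorm ℤ)), Odd Dt.c → ∀ (β : ℤ) (ι : K →+* ℂ) (d₁ : KolyvaginHeegnerData Dt β ι 1),
              ¬ ∃ Q : (W.baseChange (ringClassField K ι 1)).toAffine.Point, (2 : ℤ) • Q = d₁.derivedPoint))
    (hWit : ∀ (W : WeierstrassCurve ℚ) [W.IsElliptic] [W.IsGloballyMinimal] [NeZero (W.conductorNorm ℤ)],
      ¬ W.HasCM → W.analyticRank = 1 → Nat.card (W.selmerGroup 2) = 2 → Odd W.tamagawaProduct →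
      (∀ n : ℕ, 0 < n → W.HasSurjectiveModNGaloisRep ((2 : ℤ) ^ n)) →
      (∃ v : HeightOneSpectrum (𝓞 ℚ), ((2 : ℕ) : 𝓞 ℚ) ∉ v.asIdeal ∧ ((W.conductorNorm ℤ : ℕ) : 𝓞 ℚ) ∈ v.asIdeal ∧ W.HasMultiplicativeReductionAt v) →
      ∀ (K : Type) [Field K] [NumberField K], IsImaginaryQuadratic K → Odd (NumberField.discr K) → NumberField.discr K ≠ -3 →
        SatisfiesHeegnerHypothesis (W.conductorNorm ℤ) K →
      ∀ (Dt : ModularParametrizationData W (W.conductorNorm ℤ)), Odd Dt.c →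
      ∀ (β : ℤ) (ι : K →+* ℂ) (d₁ : KolyvaginHeegnerData Dt β ι 1), ¬ IsOfFinAddOrder d₁.derivedPoint →
      ∀ (M₀ : ℕ), (∃ Q : (W.baseChange (ringClassField K ι 1)).toAffine.Point, ((2 ^ M₀ : ℕ) : ℤ) • Q = d₁.derivedPoint) →
        (¬ ∃ Q : (W.baseChange (ringClassField K ι 1)).toAffine.Point, ((2 ^ (M₀ + 1) : ℕ) : ℤ) • Q = d₁.derivedPoint) → 2 ≤ M₀ →
      ∀ (Wd : WeierstrassCurve ℚ) [Wd.IsElliptic] [Wd.IsGloballyMinimal],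
        (∃ C : VariableChange ℚ, C • W.quadraticTwist (NumberField.discr K : ℚ) = Wd) →
        ((W.Δ < 0 ∧ padicValNat 2 Wd.tamagawaProduct ≤ 1) ∨ padicValNat 2 Wd.tamagawaProduct = 0) → Nat.card (Wd.selmerGroup 2) ≠ 1 →
        ∃ (n : ℕ) (d : KolyvaginHeegnerData Dt β ι n), Squarefree n ∧
          (∀ ℓ ∈ n.primeFactors, Zhang2014.IsKolyvaginPrime (W.conductorNorm ℤ) W K 2 ℓ ∧ 2 ≤ Zhang2014.kolyvaginIndex W 2 ℓ ∧
            ∃ (v : HeightOneSpectrum (𝓞 ℚ)) (𝔓 : Ideal (absIntegers (𝓞 ℚ) ℚ)) (h : absoluteGaloisGroup ℚ),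
              ((ℓ : ℕ) : 𝓞 ℚ) ∈ v.asIdeal ∧ 𝔓 ∈ v.primesAbove ∧ IsArithFrobAt (𝓞 ℚ) h 𝔓 ∧ ∃ u : W.geomTorsion ((2 : ℕ) : ℤ), h • u ≠ u) ∧
          ¬ ∃ Q : (W.baseChange (ringClassField K ι n)).toAffine.Point, (2 : ℤ) • Q = d.derivedPoint) :
    ∀ (W : WeierstrassCurve ℚ) [W.IsElliptic] [W.IsGloballyMinimal] [NeZero (W.conductorNorm ℤ)],
      ¬ W.HasCM → W.analyticRank = 1 → Nat.card (W.selmerGroup 2) = 2 → Odd W.tamagawaProduct →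
      (∀ n : ℕ, 0 < n → W.HasSurjectiveModNGaloisRep ((2 : ℤ) ^ n)) →
      (∃ v : HeightOneSpectrum (𝓞 ℚ), ((2 : ℕ) : 𝓞 ℚ) ∉ v.asIdeal ∧ ((W.conductorNorm ℤ : ℕ) : 𝓞 ℚ) ∈ v.asIdeal ∧ W.HasMultiplicativeReductionAt v) →
      BSDp W 2 := by
  refine minimalTwinBSDTwo_onOddCut_of_wall_of_frobeniusFrameDoorSupply_of_witnessSupply_of_facts hQ2 hGZ hGZK hmod hMilneC hMP hAU hCes hS1 ?_ hWit
  intro W _ _ _ hcm hr hSel hT hρ hv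
  obtain ⟨h4, K, iF, iN, hK, hodd, h3, hH, hq, hLv, hpos, iT, hdoor⟩ := hP W hcm hr hSel hT hρ hv
  obtain ⟨hno3, hcount⟩ := frobeniusConditions_of_primeFrame W K hK hodd hH hq hpos
  exact ⟨h4, K, iF, iN, hK, hodd, h3, hH, hLv, hno3, hcount, iT, hdoor⟩

end Summit.BirchSwinnertonDyer.BirchSwinnertonDyer.Theorems.GenusExact.TwinSwap.TwinAnnihilation

end
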